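import Mathlib
import HarnessLib
import Summits.ValiantsHypothesis.ValiantsHypothesis.Theorems.LacunarySymmetroidMatrixDescartesProductPlusOneCurvatureMargin

/-!
# LINE (A) `product_plus_one` (crux `MatrixDescartes`, stmt-ValiantsHypothesis-18050, V1) — W-CB §31/§32 (T-loc): the LOBE MARGIN `r²/2`
# (inside its ring a knee's order-6 image has log-concavity ≥ r²/2, every L₃ support) and the TILT CELL «one lobe + background of defect ≤ 2p²»

Pen val-idea-25 g6 memo §31.3 (Z-LCV) «L₃ lobes: −(log β̃)″ ≥ m·ρ_t² with m = 2.066 (b = 2a, ρ_t = b) ↑» (located) and §31.2 TILT CONDITION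
`m_Z·ρ_t² > max κ_ℓ·ρ_ℓ²`; val-lit-p8 g17 memo `NOTE-p8g17-18050-pure-2N-law.md` §11.  With the free slow knee's `κ = 2p²` (✓/⧗ `…SlowKneeDefect`) and
`ρ_t ≥ 2p`, ANY certified margin `m > 1/2` closes the (T-loc) instance «one lobe + poles + free slow knees»; this file certifies `m = 1/2` STRICTLY,
pointwise, for every support whose smaller ring root satisfies `Y₋ ≥ 1/28` (`ψp ≤ −r²/28`) — which holds for the middle-rate knee whenever `s ≥ 2p`
and for the fast knee always (§3: `784c₀ + 5040r⁴ − 28r²c₁ = 10080p⁴ + 211008p³t + … ≥ 0`, `t = s − 2p`).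
Currency of ✓ `…LobeCell` §1 (`P = c₀ψ² + c₁ψ³ + kψ⁴ = kψ²(ψ−ψm)(ψ−ψp)`, `θP = P′ψ₂`, `θ²P = P″ψ₂² + P′ψ₃`, closure laws of rate `r`).

* §1 `lobe_roots_sharp` (✓ `lobe_roots` + `ψp ≤ −r²/28` under `kr²/14 ≤ c₁`, `28r²c₁ ≤ 784c₀ + kr⁴`); §2 `lobeMargin_core` + ★ `lobeImage_margin_alg`:
  `−r²/4 < ψm < ψ < ψp ≤ −r²/28`, Vieta, closure ⇒ `(r²/2)·P² < (θP)² − P·θ²P` (identity `… = k²ψ⁴·[w·dm²·Gp + w·d²·(Gm − 2dm²) + (6w − r²/2)·d²dm²]`,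
  `w = −ψ`, `d = ψp−ψ`, `dm = ψ−ψm`; case `12w ≥ r²` termwise, case `12w < r²` via `Gp > (2r²/3)(−ψp)`, `w ≥ −ψp ≥ r²/28`, `d < r²/21`);
  §3 families `midKnee_margin_conditions` (`2p ≤ s`) / `fastKnee_margin_conditions` + packaged ★ `midKnee_lobeImage_margin` / ★ `fastKnee_lobeImage_margin`;
* §4 ★★ `midKnee_lobe_tilt_no_three_zeros` — THE (T-loc) TILT CELL (tower form): one middle-rate knee in its ring (`s ≥ 2p`) + any background of positive
  θ-towers with log-curvature defect `≤ 2p²` ⇒ `P_s(φ₁) + Σ B i` has no three zeros (✓E4a `no_three_zeros_of_logCurvature_margin` + `replicator_curvature_bound`).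

HONEST FRAMING: helper algebra + one G-cell; proves nothing about `WronskianBudgetK3` / `OneChangeFloorK3` / the stubs / 18050 / `MatrixDescartes`; `VP ≠ VNP` is
NOT proved.  No definitions, no named facts, no sorry; Mathlib + ✓E4a only.
-/

set_option linter.dupNamespace false

namespace Summit.ValiantsHypothesis.ValiantsHypothesis.Theorems.LacunarySymmetroidMatrixDescartes

namespace ProductPlusOne

/-! ### §1 The ring's roots, with the lower bound on `Y₋` -/

/-- **Ring roots with `ψp ≤ −r²/28`**: as ✓ `lobe_roots`, plus: if `360r² ≤ c₁` (i.e. `kr²/14 ≤ c₁` for `k = 5040`) and `28r²c₁ ≤ 784c₀ + kr⁴`, the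
root nearer zero satisfies `ψp ≤ −r²/28` (the knee's ring stays at log-distance where `Y ≥ 1/28`). [this file's lemma] -/
theorem lobe_roots_sharp {k r c₀ c₁ : ℝ} (hk : 0 < k) (hc0 : 0 < c₀) (hc1 : 0 < c₁) (hD : 4 * k * c₀ < c₁ ^ 2)
    (hc1' : c₁ < k * r ^ 2 / 2) (hq : 0 < k * r ^ 4 / 4 - r ^ 2 * c₁ + 4 * c₀)
    (h14 : k * r ^ 2 / 14 ≤ c₁) (h28 : 28 * r ^ 2 * c₁ ≤ 784 * c₀ + k * r ^ 4) :
    ∃ ψm ψp : ℝ, 0 < r ^ 2 + 4 * ψm ∧ ψm < ψp ∧ ψp < 0 ∧ ψp ≤ -(r ^ 2) / 28 ∧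
      c₀ = k * (ψm * ψp) ∧ c₁ = -(k * (ψm + ψp)) := by
  obtain ⟨σ, hσ0, hσσ⟩ : ∃ σ : ℝ, 0 < σ ∧ σ * σ = c₁ ^ 2 - 4 * k * c₀ :=
    ⟨Real.sqrt (c₁ ^ 2 - 4 * k * c₀), Real.sqrt_pos.2 (by linarith), Real.mul_self_sqrt (by linarith)⟩
  have hk2 : 0 < 2 * k := by linarith
  refine ⟨(-c₁ - σ) / (2 * k), (-c₁ + σ) / (2 * k), ?_, ?_, ?_, ?_, ?_, ?_⟩
  · have hR : 0 < k * r ^ 2 / 2 - c₁ := by linarith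
    have hσlt : σ < k * r ^ 2 / 2 - c₁ := by
      have h' : σ * σ < (k * r ^ 2 / 2 - c₁) * (k * r ^ 2 / 2 - c₁) := by rw [hσσ]; nlinarith
      by_contra hle
      push Not at hle
      nlinarith [mul_le_mul hle hle hR.le (hR.le.trans hle)]
    have : 0 < k * r ^ 2 - 2 * c₁ - 2 * σ := by linarith
    have hex : r ^ 2 + 4 * ((-c₁ - σ) / (2 * k)) = (k * r ^ 2 - 2 * c₁ - 2 * σ) / k := by field_simp; ring
    rw [hex]; exact div_pos this hk
  · exact div_lt_div_of_pos_right (by linarith) hk2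
  · have hσlt : σ < c₁ := by
      by_contra hle
      push Not at hle
      nlinarith [mul_le_mul hle hle hc1.le (hc1.le.trans hle)]
    exact div_neg_of_neg_of_pos (by linarith) hk2
  · -- `σ ≤ c₁ − kr²/14`, hence `ψp = (−c₁+σ)/(2k) ≤ −r²/28`
    have hR : 0 ≤ c₁ - k * r ^ 2 / 14 := by linarith
    have hσle : σ ≤ c₁ - k * r ^ 2 / 14 := by
      have h' : σ * σ ≤ (c₁ - k * r ^ 2 / 14) * (c₁ - k * r ^ 2 / 14) := by rw [hσσ]; nlinarith
      by_contra hlt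
      push Not at hlt
      nlinarith [mul_lt_mul'' hlt hlt hR hR]
    rw [div_le_iff₀ hk2]
    linarith
  · field_simp
    linear_combination hσσ
  · field_simp
    ring

/-! ### §2 The margin -/

/-- The core inequality behind the margin: with `w = −ψ`, `d = ψp − ψ`, `dm = ψ − ψm`,
`w·dm²·Gp + w·d²·(Gm − 2dm²) + (6w − r²/2)·d²dm² > 0` on `−r²/4 < ψm < ψ < ψp ≤ −r²/28`. [this file's lemma] -/
theorem lobeMargin_core {r ψm ψp ψ : ℝ} (h4 : 0 < r ^ 2 + 4 * ψm) (h1 : ψm < ψ) (h2 : ψ < ψp)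
    (hp28 : ψp ≤ -(r ^ 2) / 28) :
    0 < (-ψ) * (ψ - ψm) ^ 2 * (-ψp * (r ^ 2 + 4 * ψ) + 2 * (-ψ) * (ψp - ψ))
          + (-ψ) * (ψp - ψ) ^ 2 * (-ψm * (r ^ 2 + 4 * ψm) + 2 * (ψ - ψm) * (-ψm))
          + (6 * (-ψ) - r ^ 2 / 2) * ((ψp - ψ) ^ 2 * (ψ - ψm) ^ 2) := by
  have hm0 : ψm < 0 := by linarith
  have hr2 : 0 < r ^ 2 := by linarith
  have hp0 : ψp < 0 := by
    have : -(r ^ 2) / 28 < 0 := by linarith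
    linarith
  have hψ : ψ < 0 := h2.trans hp0
  have hw : 0 < -ψ := by linarith
  have hd : 0 < ψp - ψ := by linarith
  have hdm : 0 < ψ - ψm := by linarith
  have hr4w : 0 < r ^ 2 + 4 * ψ := by linarith
  have hGp : 0 < -ψp * (r ^ 2 + 4 * ψ) + 2 * (-ψ) * (ψp - ψ) := by
    have := mul_pos (neg_pos.2 hp0) hr4w; have := mul_pos hw hd; linarith
  have hGm2 : 0 ≤ -ψm * (r ^ 2 + 4 * ψm) + 2 * (ψ - ψm) * (-ψm) := by
    have := mul_pos (neg_pos.2 hm0) h4; have := mul_pos hdm (neg_pos.2 hm0); linarith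
  have t1 : 0 < (-ψ) * (ψ - ψm) ^ 2 * (-ψp * (r ^ 2 + 4 * ψ) + 2 * (-ψ) * (ψp - ψ)) :=
    mul_pos (mul_pos hw (pow_pos hdm 2)) hGp
  have t2 : 0 ≤ (-ψ) * (ψp - ψ) ^ 2 * (-ψm * (r ^ 2 + 4 * ψm) + 2 * (ψ - ψm) * (-ψm)) :=
    mul_nonneg (mul_nonneg hw.le (sq_nonneg _)) hGm2
  have hD2 : 0 < (ψp - ψ) ^ 2 * (ψ - ψm) ^ 2 := mul_pos (pow_pos hd 2) (pow_pos hdm 2)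
  rcases le_or_gt (r ^ 2) (12 * (-ψ)) with hA | hB
  · -- `12w ≥ r²`: termwise
    have t3 : 0 ≤ (6 * (-ψ) - r ^ 2 / 2) * ((ψp - ψ) ^ 2 * (ψ - ψm) ^ 2) :=
      mul_nonneg (by linarith) hD2.le
    linarith
  · -- `12w < r²`: `Gp ≥ (2r²/3)(−ψp)`, `w ≥ −ψp ≥ r²/28`, `d < r²/21`
    have hwp : r ^ 2 / 28 ≤ -ψp := by linarith
    have hwp0 : 0 < -ψp := by linarith
    have hwge : -ψp ≤ -ψ := by linarith
    have hd21 : ψp - ψ < r ^ 2 / 21 := by linarith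
    have hGp' : 2 * r ^ 2 / 3 * -ψp ≤ -ψp * (r ^ 2 + 4 * ψ) + 2 * (-ψ) * (ψp - ψ) := by
      have : 2 * r ^ 2 / 3 ≤ r ^ 2 + 4 * ψ := by linarith
      have := mul_le_mul_of_nonneg_left this hwp0.le
      have := mul_pos hw hd
      linarith
    have hwwp : r ^ 2 / 28 * (r ^ 2 / 28) ≤ (-ψ) * -ψp :=
      mul_le_mul (le_trans hwp hwge) hwp (by positivity) hw.le
    have hd2 : (ψp - ψ) ^ 2 < r ^ 2 / 21 * (r ^ 2 / 21) := by
      rw [pow_two]; exact mul_lt_mul'' hd21 hd21 hd.le hd.le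
    have hwd2 : r ^ 2 / 28 * (ψp - ψ) ^ 2 ≤ (-ψ) * (ψp - ψ) ^ 2 :=
      mul_le_mul_of_nonneg_right (le_trans hwp hwge) (sq_nonneg _)
    have h23 : (0 : ℝ) ≤ 2 * r ^ 2 / 3 := by positivity
    have e1 : 2 * r ^ 2 / 3 * (r ^ 2 / 28 * (r ^ 2 / 28)) ≤ 2 * r ^ 2 / 3 * ((-ψ) * -ψp) :=
      mul_le_mul_of_nonneg_left hwwp h23
    have e5 : r ^ 2 * (ψp - ψ) ^ 2 < r ^ 2 * (r ^ 2 / 21 * (r ^ 2 / 21)) := mul_lt_mul_of_pos_left hd2 hr2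
    have hr6 : 0 < r ^ 2 * (r ^ 2 * r ^ 2) := mul_pos hr2 (mul_pos hr2 hr2)
    have inner : 0 < 2 * r ^ 2 / 3 * ((-ψ) * -ψp) + (6 * (-ψ) - r ^ 2 / 2) * (ψp - ψ) ^ 2 := by
      linarith [e1, hwd2, e5, hr6]
    have step : 2 * r ^ 2 / 3 * ((-ψ) * -ψp) * (ψ - ψm) ^ 2
        ≤ (-ψ) * (ψ - ψm) ^ 2 * (-ψp * (r ^ 2 + 4 * ψ) + 2 * (-ψ) * (ψp - ψ)) := by
      have := mul_le_mul_of_nonneg_left hGp' (mul_nonneg hw.le (sq_nonneg (ψ - ψm)))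
      linarith [this]
    have hdm2 : 0 < (ψ - ψm) ^ 2 := pow_pos hdm 2
    linarith [step, t2, mul_pos inner hdm2]

/-- ★ **LOBE MARGIN `m = 1/2` (strict, pointwise)**: binomial tower of rate `r`, ring `c₀ + c₁ψ + kψ² = k(ψ−ψm)(ψ−ψp)` with
`−r²/4 < ψm < ψ < ψp ≤ −r²/28`, `k ≠ 0`, closure laws ⇒ `(r²/2)·P² < (θP)² − P·θ²P`. [this file's theorem] -/
theorem lobeImage_margin_alg {k r ψm ψp ψ ψ₂ ψ₃ c₀ c₁ : ℝ} (hk : k ≠ 0) (h4 : 0 < r ^ 2 + 4 * ψm)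
    (h1 : ψm < ψ) (h2 : ψ < ψp) (hp28 : ψp ≤ -(r ^ 2) / 28) (hc0 : c₀ = k * (ψm * ψp)) (hc1 : c₁ = -(k * (ψm + ψp)))
    (h2c : ψ₂ ^ 2 = r ^ 2 * ψ ^ 2 + 4 * ψ ^ 3) (h3c : ψ₃ = r ^ 2 * ψ + 6 * ψ ^ 2) :
    r ^ 2 / 2 * (c₀ * ψ ^ 2 + c₁ * ψ ^ 3 + k * ψ ^ 4) ^ 2
      < ((2 * c₀ * ψ + 3 * c₁ * ψ ^ 2 + 4 * k * ψ ^ 3) * ψ₂) ^ 2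
      - (c₀ * ψ ^ 2 + c₁ * ψ ^ 3 + k * ψ ^ 4)
        * ((2 * c₀ + 6 * c₁ * ψ + 12 * k * ψ ^ 2) * ψ₂ ^ 2 + (2 * c₀ * ψ + 3 * c₁ * ψ ^ 2 + 4 * k * ψ ^ 3) * ψ₃) := by
  have hp0 : ψp < 0 := by
    have : -(r ^ 2) / 28 < 0 := by linarith
    linarith
  have hψ : ψ < 0 := h2.trans hp0
  have key : ((2 * c₀ * ψ + 3 * c₁ * ψ ^ 2 + 4 * k * ψ ^ 3) * ψ₂) ^ 2
      - (c₀ * ψ ^ 2 + c₁ * ψ ^ 3 + k * ψ ^ 4)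
        * ((2 * c₀ + 6 * c₁ * ψ + 12 * k * ψ ^ 2) * ψ₂ ^ 2 + (2 * c₀ * ψ + 3 * c₁ * ψ ^ 2 + 4 * k * ψ ^ 3) * ψ₃)
      - r ^ 2 / 2 * (c₀ * ψ ^ 2 + c₁ * ψ ^ 3 + k * ψ ^ 4) ^ 2
      = k ^ 2 * ψ ^ 4 * ((-ψ) * (ψ - ψm) ^ 2 * (-ψp * (r ^ 2 + 4 * ψ) + 2 * (-ψ) * (ψp - ψ))
          + (-ψ) * (ψp - ψ) ^ 2 * (-ψm * (r ^ 2 + 4 * ψm) + 2 * (ψ - ψm) * (-ψm))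
          + (6 * (-ψ) - r ^ 2 / 2) * ((ψp - ψ) ^ 2 * (ψ - ψm) ^ 2)) := by
    rw [mul_pow, h2c, h3c, hc0, hc1]; ring
  have hk2 : 0 < k ^ 2 := lt_of_le_of_ne (sq_nonneg k) (Ne.symm (pow_ne_zero 2 hk))
  have hψ2 : 0 < ψ ^ 2 := by nlinarith [mul_pos_of_neg_of_neg hψ hψ]
  have hψ4 : 0 < ψ ^ 4 := by nlinarith [mul_pos hψ2 hψ2]
  have : 0 < ((2 * c₀ * ψ + 3 * c₁ * ψ ^ 2 + 4 * k * ψ ^ 3) * ψ₂) ^ 2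
      - (c₀ * ψ ^ 2 + c₁ * ψ ^ 3 + k * ψ ^ 4)
        * ((2 * c₀ + 6 * c₁ * ψ + 12 * k * ψ ^ 2) * ψ₂ ^ 2 + (2 * c₀ * ψ + 3 * c₁ * ψ ^ 2 + 4 * k * ψ ^ 3) * ψ₃)
      - r ^ 2 / 2 * (c₀ * ψ ^ 2 + c₁ * ψ ^ 3 + k * ψ ^ 4) ^ 2 := by
    rw [key]; exact mul_pos (mul_pos hk2 hψ4) (lobeMargin_core h4 h1 h2 hp28)
  exact sub_pos.mp this

/-! ### §3 The LINE families -/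

section Families

variable {p s : ℝ}

/-- **Middle-rate knee, `s ≥ 2p`**: the two extra conditions of `lobe_roots_sharp` hold (`784c₀(s) + 5040s⁴ − 28s²c₁(s) = 10080p⁴ + 211008p³t +
296352p²t² + 138432pt³ + 21168t⁴`, `t = s − 2p`). [this file's lemma] -/
theorem midKnee_margin_conditions (hp : 0 < p) (h2 : 2 * p ≤ s) :
    5040 * s ^ 2 / 14 ≤ (240 * ((3 * s + p) * (2 * s - p))) ∧ 28 * s ^ 2 * (240 * ((3 * s + p) * (2 * s - p))) ≤ 784 * (6 * ((s - p) * (2 * s - p) * (2 * s + p) * (3 * s + p))) + 5040 * s ^ 4 := by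
  obtain ⟨t, ht, rfl⟩ : ∃ t : ℝ, 0 ≤ t ∧ s = 2 * p + t := ⟨s - 2 * p, by linarith, by ring⟩
  constructor
  · nlinarith [mul_nonneg hp.le ht, sq_nonneg t, sq_nonneg p]
  · have : 784 * (6 * ((2 * p + t - p) * (2 * (2 * p + t) - p) * (2 * (2 * p + t) + p) * (3 * (2 * p + t) + p)))
        + 5040 * (2 * p + t) ^ 4 - 28 * (2 * p + t) ^ 2 * (240 * ((3 * (2 * p + t) + p) * (2 * (2 * p + t) - p)))
        = 10080 * p ^ 4 + 211008 * p ^ 3 * t + 296352 * p ^ 2 * t ^ 2 + 138432 * p * t ^ 3 + 21168 * t ^ 4 := by ring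
    have hpos : 0 ≤ 10080 * p ^ 4 + 211008 * p ^ 3 * t + 296352 * p ^ 2 * t ^ 2 + 138432 * p * t ^ 3 + 21168 * t ^ 4 := by
      positivity
    linarith

/-- **Fast knee** (`0 < p, s`): the two extra conditions of `lobe_roots_sharp` hold. [this file's lemma] -/
theorem fastKnee_margin_conditions (hp : 0 < p) (hs : 0 < s) :
    5040 * (p + s) ^ 2 / 14 ≤ (120 * (12 * p ^ 2 + 26 * p * s + 12 * s ^ 2)) ∧
      28 * (p + s) ^ 2 * (120 * (12 * p ^ 2 + 26 * p * s + 12 * s ^ 2)) ≤ 784 * (6 * (12 * p ^ 4 + 56 * p ^ 3 * s + 89 * p ^ 2 * s ^ 2 + 56 * p * s ^ 3 + 12 * s ^ 4)) + 5040 * (p + s) ^ 4 := by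
  constructor
  · nlinarith [mul_pos hp hs, sq_nonneg p, sq_nonneg s]
  · have : 784 * (6 * (12 * p ^ 4 + 56 * p ^ 3 * s + 89 * p ^ 2 * s ^ 2 + 56 * p * s ^ 3 + 12 * s ^ 4)) + 5040 * (p + s) ^ 4 - 28 * (p + s) ^ 2 * (120 * (12 * p ^ 2 + 26 * p * s + 12 * s ^ 2))
        = 21168 * p ^ 4 + 115584 * p ^ 3 * s + 193536 * p ^ 2 * s ^ 2 + 115584 * p * s ^ 3 + 21168 * s ^ 4 := by ring
    have hpos : 0 ≤ 21168 * p ^ 4 + 115584 * p ^ 3 * s + 193536 * p ^ 2 * s ^ 2 + 115584 * p * s ^ 3 + 21168 * s ^ 4 := by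
      positivity
    linarith

/-- ★ **Middle-rate knee (`s ≥ 2p`), inside its ring: margin `s²/2`** — `c₀(s) + c₁(s)ψ + 5040ψ² < 0`, closure laws with rate `s`
⇒ `(s²/2)·P² < (θP)² − P·θ²P`. [this file's theorem] -/
theorem midKnee_lobeImage_margin (hp : 0 < p) (h2 : 2 * p ≤ s) {ψ ψ₂ ψ₃ : ℝ}
    (hring : (6 * ((s - p) * (2 * s - p) * (2 * s + p) * (3 * s + p))) + (240 * ((3 * s + p) * (2 * s - p))) * ψ + 5040 * ψ ^ 2 < 0)
    (h2c : ψ₂ ^ 2 = s ^ 2 * ψ ^ 2 + 4 * ψ ^ 3) (h3c : ψ₃ = s ^ 2 * ψ + 6 * ψ ^ 2) :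
    s ^ 2 / 2 * ((6 * ((s - p) * (2 * s - p) * (2 * s + p) * (3 * s + p))) * ψ ^ 2 + (240 * ((3 * s + p) * (2 * s - p))) * ψ ^ 3 + 5040 * ψ ^ 4) ^ 2
      < ((2 * (6 * ((s - p) * (2 * s - p) * (2 * s + p) * (3 * s + p))) * ψ + 3 * (240 * ((3 * s + p) * (2 * s - p))) * ψ ^ 2 + 4 * 5040 * ψ ^ 3) * ψ₂) ^ 2
        - ((6 * ((s - p) * (2 * s - p) * (2 * s + p) * (3 * s + p))) * ψ ^ 2 + (240 * ((3 * s + p) * (2 * s - p))) * ψ ^ 3 + 5040 * ψ ^ 4)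
          * ((2 * (6 * ((s - p) * (2 * s - p) * (2 * s + p) * (3 * s + p))) + 6 * (240 * ((3 * s + p) * (2 * s - p))) * ψ + 12 * 5040 * ψ ^ 2) * ψ₂ ^ 2 + (2 * (6 * ((s - p) * (2 * s - p) * (2 * s + p) * (3 * s + p))) * ψ + 3 * (240 * ((3 * s + p) * (2 * s - p))) * ψ ^ 2 + 4 * 5040 * ψ ^ 3) * ψ₃) := by
  have hps : p < s := by linarith
  have h1 : 0 < s - p := by linarith
  have h2' : 0 < 2 * s - p := by linarith
  have h3 : 0 < 2 * s + p := by linarith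
  have h4 : 0 < 3 * s + p := by linarith
  have hs : 0 < s := by linarith
  have hc0 : 0 < (6 * ((s - p) * (2 * s - p) * (2 * s + p) * (3 * s + p))) := by positivity
  have hc1 : 0 < (240 * ((3 * s + p) * (2 * s - p))) := by positivity
  have hD : 4 * 5040 * (6 * ((s - p) * (2 * s - p) * (2 * s + p) * (3 * s + p))) < (240 * ((3 * s + p) * (2 * s - p))) ^ 2 := by
    have : (240 * ((3 * s + p) * (2 * s - p))) ^ 2 - 4 * 5040 * (6 * ((s - p) * (2 * s - p) * (2 * s + p) * (3 * s + p))) = 240 * ((3 * s + p) * (2 * s - p)) * (432 * s ^ 2 + 264 * p * s + 264 * p ^ 2) := by ring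
    have hpos : 0 < 240 * ((3 * s + p) * (2 * s - p)) * (432 * s ^ 2 + 264 * p * s + 264 * p ^ 2) := by positivity
    linarith
  have hc1' : (240 * ((3 * s + p) * (2 * s - p))) < 5040 * s ^ 2 / 2 := by nlinarith [mul_pos hp hs]
  have hq : 0 < 5040 * s ^ 4 / 4 - s ^ 2 * (240 * ((3 * s + p) * (2 * s - p))) + 4 * (6 * ((s - p) * (2 * s - p) * (2 * s + p) * (3 * s + p))) := by
    have : 5040 * s ^ 4 / 4 - s ^ 2 * (240 * ((3 * s + p) * (2 * s - p))) + 4 * (6 * ((s - p) * (2 * s - p) * (2 * s + p) * (3 * s + p))) = 24 * (p ^ 2 + p * s + s ^ 2) ^ 2 + 84 * s ^ 4 := by ring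
    rw [this]; positivity
  obtain ⟨h14, h28⟩ := midKnee_margin_conditions hp h2
  obtain ⟨ψm, ψp, h4r, hmp, hp0, hp28, hv0, hv1⟩ :=
    lobe_roots_sharp (r := s) (by norm_num : (0 : ℝ) < 5040) hc0 hc1 hD hc1' hq h14 h28
  have hprod : (ψ - ψm) * (ψ - ψp) < 0 := by
    have : (6 * ((s - p) * (2 * s - p) * (2 * s + p) * (3 * s + p))) + (240 * ((3 * s + p) * (2 * s - p))) * ψ + 5040 * ψ ^ 2 = 5040 * ((ψ - ψm) * (ψ - ψp)) := by rw [hv0, hv1]; ring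
    rw [this] at hring; linarith
  have hl : ψm < ψ ∧ ψ < ψp := by
    rcases mul_neg_iff.1 hprod with ⟨ha, hb⟩ | ⟨ha, hb⟩
    · exact ⟨by linarith, by linarith⟩
    · exfalso; linarith
  exact lobeImage_margin_alg (by norm_num : (5040 : ℝ) ≠ 0) h4r hl.1 hl.2 hp28 hv0 hv1 h2c h3c

/-- ★ **Fast knee, inside its ring: margin `(p+s)²/2`** — `c₀(q) + c₁(q)ψ + 5040ψ² < 0`, closure laws with rate `p+s`
⇒ `((p+s)²/2)·P² < (θP)² − P·θ²P`. [this file's theorem] -/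
theorem fastKnee_lobeImage_margin (hp : 0 < p) (hs : 0 < s) {ψ ψ₂ ψ₃ : ℝ}
    (hring : (6 * (12 * p ^ 4 + 56 * p ^ 3 * s + 89 * p ^ 2 * s ^ 2 + 56 * p * s ^ 3 + 12 * s ^ 4)) + (120 * (12 * p ^ 2 + 26 * p * s + 12 * s ^ 2)) * ψ + 5040 * ψ ^ 2 < 0)
    (h2c : ψ₂ ^ 2 = (p + s) ^ 2 * ψ ^ 2 + 4 * ψ ^ 3) (h3c : ψ₃ = (p + s) ^ 2 * ψ + 6 * ψ ^ 2) :
    (p + s) ^ 2 / 2 * ((6 * (12 * p ^ 4 + 56 * p ^ 3 * s + 89 * p ^ 2 * s ^ 2 + 56 * p * s ^ 3 + 12 * s ^ 4)) * ψ ^ 2 + (120 * (12 * p ^ 2 + 26 * p * s + 12 * s ^ 2)) * ψ ^ 3 + 5040 * ψ ^ 4) ^ 2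
      < ((2 * (6 * (12 * p ^ 4 + 56 * p ^ 3 * s + 89 * p ^ 2 * s ^ 2 + 56 * p * s ^ 3 + 12 * s ^ 4)) * ψ + 3 * (120 * (12 * p ^ 2 + 26 * p * s + 12 * s ^ 2)) * ψ ^ 2 + 4 * 5040 * ψ ^ 3) * ψ₂) ^ 2
        - ((6 * (12 * p ^ 4 + 56 * p ^ 3 * s + 89 * p ^ 2 * s ^ 2 + 56 * p * s ^ 3 + 12 * s ^ 4)) * ψ ^ 2 + (120 * (12 * p ^ 2 + 26 * p * s + 12 * s ^ 2)) * ψ ^ 3 + 5040 * ψ ^ 4)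
          * ((2 * (6 * (12 * p ^ 4 + 56 * p ^ 3 * s + 89 * p ^ 2 * s ^ 2 + 56 * p * s ^ 3 + 12 * s ^ 4)) + 6 * (120 * (12 * p ^ 2 + 26 * p * s + 12 * s ^ 2)) * ψ + 12 * 5040 * ψ ^ 2) * ψ₂ ^ 2 + (2 * (6 * (12 * p ^ 4 + 56 * p ^ 3 * s + 89 * p ^ 2 * s ^ 2 + 56 * p * s ^ 3 + 12 * s ^ 4)) * ψ + 3 * (120 * (12 * p ^ 2 + 26 * p * s + 12 * s ^ 2)) * ψ ^ 2 + 4 * 5040 * ψ ^ 3) * ψ₃) := by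
  have hc0 : 0 < (6 * (12 * p ^ 4 + 56 * p ^ 3 * s + 89 * p ^ 2 * s ^ 2 + 56 * p * s ^ 3 + 12 * s ^ 4)) := by positivity
  have hc1 : 0 < (120 * (12 * p ^ 2 + 26 * p * s + 12 * s ^ 2)) := by positivity
  have hD : 4 * 5040 * (6 * (12 * p ^ 4 + 56 * p ^ 3 * s + 89 * p ^ 2 * s ^ 2 + 56 * p * s ^ 3 + 12 * s ^ 4)) < (120 * (12 * p ^ 2 + 26 * p * s + 12 * s ^ 2)) ^ 2 := by
    have : (120 * (12 * p ^ 2 + 26 * p * s + 12 * s ^ 2)) ^ 2 - 4 * 5040 * (6 * (12 * p ^ 4 + 56 * p ^ 3 * s + 89 * p ^ 2 * s ^ 2 + 56 * p * s ^ 3 + 12 * s ^ 4))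
        = 622080 * p ^ 4 + 2211840 * p ^ 3 * s + 3116160 * p ^ 2 * s ^ 2 + 2211840 * p * s ^ 3 + 622080 * s ^ 4 := by ring
    have hpos : 0 < 622080 * p ^ 4 + 2211840 * p ^ 3 * s + 3116160 * p ^ 2 * s ^ 2 + 2211840 * p * s ^ 3 + 622080 * s ^ 4 := by
      positivity
    linarith
  have hc1' : (120 * (12 * p ^ 2 + 26 * p * s + 12 * s ^ 2)) < 5040 * (p + s) ^ 2 / 2 := by nlinarith [mul_pos hp hs]
  have hq : 0 < 5040 * (p + s) ^ 4 / 4 - (p + s) ^ 2 * (120 * (12 * p ^ 2 + 26 * p * s + 12 * s ^ 2)) + 4 * (6 * (12 * p ^ 4 + 56 * p ^ 3 * s + 89 * p ^ 2 * s ^ 2 + 56 * p * s ^ 3 + 12 * s ^ 4)) := by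
    have : 5040 * (p + s) ^ 4 / 4 - (p + s) ^ 2 * (120 * (12 * p ^ 2 + 26 * p * s + 12 * s ^ 2)) + 4 * (6 * (12 * p ^ 4 + 56 * p ^ 3 * s + 89 * p ^ 2 * s ^ 2 + 56 * p * s ^ 3 + 12 * s ^ 4)) = 24 * (p ^ 2 + p * s + s ^ 2) ^ 2 + 84 * (p + s) ^ 4 := by ring
    rw [this]; positivity
  obtain ⟨h14, h28⟩ := fastKnee_margin_conditions hp hs
  obtain ⟨ψm, ψp, h4r, hmp, hp0, hp28, hv0, hv1⟩ :=
    lobe_roots_sharp (r := p + s) (by norm_num : (0 : ℝ) < 5040) hc0 hc1 hD hc1' hq h14 h28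
  have hprod : (ψ - ψm) * (ψ - ψp) < 0 := by
    have : (6 * (12 * p ^ 4 + 56 * p ^ 3 * s + 89 * p ^ 2 * s ^ 2 + 56 * p * s ^ 3 + 12 * s ^ 4)) + (120 * (12 * p ^ 2 + 26 * p * s + 12 * s ^ 2)) * ψ + 5040 * ψ ^ 2 = 5040 * ((ψ - ψm) * (ψ - ψp)) := by rw [hv0, hv1]; ring
    rw [this] at hring; linarith
  have hl : ψm < ψ ∧ ψ < ψp := by
    rcases mul_neg_iff.1 hprod with ⟨ha, hb⟩ | ⟨ha, hb⟩
    · exact ⟨by linarith, by linarith⟩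
    · exfalso; linarith
  exact lobeImage_margin_alg (by norm_num : (5040 : ℝ) ≠ 0) h4r hl.1 hl.2 hp28 hv0 hv1 h2c h3c

end Families

/-! ### §4 The (T-loc) cell: one middle-rate knee in its ring against a background of log-curvature defect ≤ 2p² -/

/-- ★★ **THE TILT CELL (tower form, middle-rate knee, `s ≥ 2p`).**  Window `(u,v)`, `0 ≤ u`; knee tower `φ₁, φ₂, φ₃` (`θφ₁ = φ₂`, `θφ₂ = φ₃`,
closure laws of rate `s`) with its ring containing the window (`c₀(s) + c₁(s)φ₁ + 5040φ₁² < 0`); background rows `i ∈ t` given as positive θ-towers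
`B i, B₁ i, B₂ i` with log-curvature defect at most `2p²` (`−(2p²)·B² ≤ B·B₂ − B₁²`: mid/fast poles and slow poles at `s ≥ 3p` have defect `0`
(✓ `…LobeCell` §3, ⧗ `…SlowPoleImage`), free slow knees `2p²` (⧗ `…SlowKneeDefect`)).  Then the knee's image plus the background,
`P_s(φ₁) + Σ_{i∈t} B i`, does not vanish at three points of the window — ✓E4a's margin shell with the lobe margin `s²/2 ≥ 2p²` (§3) against
✓ `replicator_curvature_bound` (`κ = 2p²`). [this file's theorem] -/
theorem midKnee_lobe_tilt_no_three_zeros {p s : ℝ} (hp : 0 < p) (h2 : 2 * p ≤ s) {φ₁ φ₂ φ₃ : ℝ → ℝ} {u v : ℝ} (hu : 0 ≤ u)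
    (hφ₁ : ∀ x ∈ Set.Ioo u v, HasDerivAt φ₁ (φ₂ x / x) x) (hφ₂ : ∀ x ∈ Set.Ioo u v, HasDerivAt φ₂ (φ₃ x / x) x)
    (hφc : ∀ x ∈ Set.Ioo u v, φ₂ x ^ 2 = s ^ 2 * φ₁ x ^ 2 + 4 * φ₁ x ^ 3 ∧ φ₃ x = s ^ 2 * φ₁ x + 6 * φ₁ x ^ 2)
    (hring : ∀ x ∈ Set.Ioo u v, (6 * ((s - p) * (2 * s - p) * (2 * s + p) * (3 * s + p))) + (240 * ((3 * s + p) * (2 * s - p))) * φ₁ x + 5040 * φ₁ x ^ 2 < 0)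
    {ι : Type*} (t : Finset ι) (B B₁ B₂ : ι → ℝ → ℝ)
    (hB : ∀ x ∈ Set.Ioo u v, ∀ i ∈ t, HasDerivAt (B i) (B₁ i x / x) x) (hB₁ : ∀ x ∈ Set.Ioo u v, ∀ i ∈ t, HasDerivAt (B₁ i) (B₂ i x / x) x)
    (hBpos : ∀ x ∈ Set.Ioo u v, ∀ i ∈ t, 0 < B i x)
    (hBcurv : ∀ x ∈ Set.Ioo u v, ∀ i ∈ t, -(2 * p ^ 2) * B i x ^ 2 ≤ B i x * B₂ i x - B₁ i x ^ 2)
    {x₁ x₂ x₃ : ℝ} (h₁ : x₁ ∈ Set.Ioo u v) (h₃ : x₃ ∈ Set.Ioo u v) (h12 : x₁ < x₂) (h23 : x₂ < x₃)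
    (hzero : ∀ x ∈ ({x₁, x₂, x₃} : Set ℝ), ((6 * ((s - p) * (2 * s - p) * (2 * s + p) * (3 * s + p))) * φ₁ x ^ 2 + (240 * ((3 * s + p) * (2 * s - p))) * φ₁ x ^ 3 + 5040 * φ₁ x ^ 4) + ∑ i ∈ t, B i x = 0) : False := by
  have h₂ : x₂ ∈ Set.Ioo u v := ⟨h₁.1.trans h12, h23.trans h₃.2⟩
  set A : ℝ → ℝ := fun x => -((6 * ((s - p) * (2 * s - p) * (2 * s + p) * (3 * s + p))) * φ₁ x ^ 2 + (240 * ((3 * s + p) * (2 * s - p))) * φ₁ x ^ 3 + 5040 * φ₁ x ^ 4) with hAdef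
  set A₁ : ℝ → ℝ := fun x => -((2 * (6 * ((s - p) * (2 * s - p) * (2 * s + p) * (3 * s + p))) * φ₁ x + 3 * (240 * ((3 * s + p) * (2 * s - p))) * φ₁ x ^ 2 + 4 * 5040 * φ₁ x ^ 3) * φ₂ x) with hA₁def
  set A₂ : ℝ → ℝ := fun x => -((2 * (6 * ((s - p) * (2 * s - p) * (2 * s + p) * (3 * s + p))) + 6 * (240 * ((3 * s + p) * (2 * s - p))) * φ₁ x + 12 * 5040 * φ₁ x ^ 2) * φ₂ x ^ 2
      + (2 * (6 * ((s - p) * (2 * s - p) * (2 * s + p) * (3 * s + p))) * φ₁ x + 3 * (240 * ((3 * s + p) * (2 * s - p))) * φ₁ x ^ 2 + 4 * 5040 * φ₁ x ^ 3) * φ₃ x) with hA₂def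
  have hA : ∀ x ∈ Set.Ioo u v, HasDerivAt A (A₁ x / x) x := by
    intro x hx
    have h1 := hφ₁ x hx
    have h := (((h1.pow 2).const_mul (6 * ((s - p) * (2 * s - p) * (2 * s + p) * (3 * s + p)))).add ((h1.pow 3).const_mul (240 * ((3 * s + p) * (2 * s - p))))).add ((h1.pow 4).const_mul (5040 : ℝ))
    refine (h.neg).congr_deriv ?_
    simp only [hA₁def, Nat.cast_ofNat]
    field_simp
    ring
  have hA' : ∀ x ∈ Set.Ioo u v, HasDerivAt A₁ (A₂ x / x) x := by
    intro x hx
    have h1 := hφ₁ x hx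
    have h2' := hφ₂ x hx
    have hpoly : HasDerivAt (fun y => 2 * (6 * ((s - p) * (2 * s - p) * (2 * s + p) * (3 * s + p))) * φ₁ y + 3 * (240 * ((3 * s + p) * (2 * s - p))) * φ₁ y ^ 2 + 4 * 5040 * φ₁ y ^ 3)
        (2 * (6 * ((s - p) * (2 * s - p) * (2 * s + p) * (3 * s + p))) * (φ₂ x / x) + 3 * (240 * ((3 * s + p) * (2 * s - p))) * (2 * φ₁ x ^ 1 * (φ₂ x / x)) + 4 * 5040 * (3 * φ₁ x ^ 2 * (φ₂ x / x))) x := by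
      have h := ((h1.const_mul (2 * (6 * ((s - p) * (2 * s - p) * (2 * s + p) * (3 * s + p))))).add ((h1.pow 2).const_mul (3 * (240 * ((3 * s + p) * (2 * s - p)))))).add ((h1.pow 3).const_mul (4 * 5040 : ℝ))
      refine h.congr_deriv ?_
      simp only [Nat.cast_ofNat]
    have h := (hpoly.mul h2').neg
    refine h.congr_deriv ?_
    simp only [hA₂def]
    field_simp
    ring
  set G : ℝ → ℝ := fun x => ∑ i ∈ t, B i x with hGdef
  set G₁ : ℝ → ℝ := fun x => ∑ i ∈ t, B₁ i x with hG₁def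
  set G₂ : ℝ → ℝ := fun x => ∑ i ∈ t, B₂ i x with hG₂def
  have hG : ∀ x ∈ Set.Ioo u v, HasDerivAt G (G₁ x / x) x := by
    intro x hx
    have h := HasDerivAt.fun_sum (u := t) (fun i hi => hB x hx i hi)
    simpa only [hG₁def, Finset.sum_div] using h
  have hG' : ∀ x ∈ Set.Ioo u v, HasDerivAt G₁ (G₂ x / x) x := by
    intro x hx
    have h := HasDerivAt.fun_sum (u := t) (fun i hi => hB₁ x hx i hi)
    simpa only [hG₂def, Finset.sum_div] using h
  have hps : p < s := by linarith
  have hc0 : 0 < (6 * ((s - p) * (2 * s - p) * (2 * s + p) * (3 * s + p))) := by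
    have h1 : 0 < s - p := by linarith
    have h2' : 0 < 2 * s - p := by linarith
    have h3 : 0 < 2 * s + p := by linarith
    have h4 : 0 < 3 * s + p := by linarith
    positivity
  have hφne : ∀ x ∈ Set.Ioo u v, φ₁ x ≠ 0 := by
    intro x hx h
    have := hring x hx
    rw [h] at this
    nlinarith
  have hApos : ∀ x ∈ Set.Ioo u v, 0 < A x := by
    intro x hx
    have hsq : 0 < φ₁ x ^ 2 := by
      rcases lt_or_gt_of_ne (hφne x hx) with h | h
      · nlinarith
      · positivity
    have : A x = φ₁ x ^ 2 * (-((6 * ((s - p) * (2 * s - p) * (2 * s + p) * (3 * s + p))) + (240 * ((3 * s + p) * (2 * s - p))) * φ₁ x + 5040 * φ₁ x ^ 2)) := by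
      simp only [hAdef]; ring
    rw [this]
    exact mul_pos hsq (by linarith [hring x hx])
  have hAmargin : ∀ x ∈ Set.Ioo u v, A x * A₂ x - A₁ x ^ 2 < -(s ^ 2 / 2) * A x ^ 2 := by
    intro x hx
    have h := midKnee_lobeImage_margin hp h2 (hring x hx) (hφc x hx).1 (hφc x hx).2
    have e1 : A x * A₂ x = ((6 * ((s - p) * (2 * s - p) * (2 * s + p) * (3 * s + p))) * φ₁ x ^ 2 + (240 * ((3 * s + p) * (2 * s - p))) * φ₁ x ^ 3 + 5040 * φ₁ x ^ 4)
        * ((2 * (6 * ((s - p) * (2 * s - p) * (2 * s + p) * (3 * s + p))) + 6 * (240 * ((3 * s + p) * (2 * s - p))) * φ₁ x + 12 * 5040 * φ₁ x ^ 2) * φ₂ x ^ 2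
          + (2 * (6 * ((s - p) * (2 * s - p) * (2 * s + p) * (3 * s + p))) * φ₁ x + 3 * (240 * ((3 * s + p) * (2 * s - p))) * φ₁ x ^ 2 + 4 * 5040 * φ₁ x ^ 3) * φ₃ x) := by
      simp only [hAdef, hA₂def]; ring
    have e2 : A₁ x ^ 2 = ((2 * (6 * ((s - p) * (2 * s - p) * (2 * s + p) * (3 * s + p))) * φ₁ x + 3 * (240 * ((3 * s + p) * (2 * s - p))) * φ₁ x ^ 2 + 4 * 5040 * φ₁ x ^ 3) * φ₂ x) ^ 2 := by
      simp only [hA₁def]; ring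
    have e3 : A x ^ 2 = ((6 * ((s - p) * (2 * s - p) * (2 * s + p) * (3 * s + p))) * φ₁ x ^ 2 + (240 * ((3 * s + p) * (2 * s - p))) * φ₁ x ^ 3 + 5040 * φ₁ x ^ 4) ^ 2 := by simp only [hAdef]; ring
    rw [e1, e2, e3]; linarith
  have hz : ∀ x ∈ ({x₁, x₂, x₃} : Set ℝ), A x = G x := by
    intro x hx
    have h := hzero x hx
    simp only [hAdef, hGdef]
    linarith
  rcases t.eq_empty_or_nonempty with ht | ht
  · have h := hz x₁ (by simp)
    have hG0 : G x₁ = 0 := by simp only [hGdef, ht, Finset.sum_empty]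
    rw [hG0] at h
    exact absurd h (hApos x₁ h₁).ne'
  · have hGpos : ∀ x ∈ Set.Ioo u v, 0 < G x := fun x hx => by
      simp only [hGdef]; exact Finset.sum_pos (fun i hi => hBpos x hx i hi) ht
    have hGcurv : ∀ x ∈ Set.Ioo u v, -(2 * p ^ 2) * G x ^ 2 ≤ G x * G₂ x - G₁ x ^ 2 := fun x hx => by
      simp only [hGdef, hG₁def, hG₂def]
      exact replicator_curvature_bound t (fun i => B i x) (fun i => B₁ i x) (fun i => B₂ i x) (2 * p ^ 2)
        (fun i hi => hBpos x hx i hi) (fun i hi => hBcurv x hx i hi)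
    have hmargin : ∀ x ∈ Set.Ioo u v, (A x * A₂ x - A₁ x ^ 2) * G x ^ 2 < (G x * G₂ x - G₁ x ^ 2) * A x ^ 2 := by
      intro x hx
      have hA2 : 0 < A x ^ 2 := pow_pos (hApos x hx) 2
      have hG2 : 0 < G x ^ 2 := pow_pos (hGpos x hx) 2
      have hs4 : 2 * p ^ 2 ≤ s ^ 2 / 2 := by nlinarith
      have l1 : (A x * A₂ x - A₁ x ^ 2) * G x ^ 2 < -(s ^ 2 / 2) * A x ^ 2 * G x ^ 2 := by
        have := mul_lt_mul_of_pos_right (hAmargin x hx) hG2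
        linarith
      have l2 : -(s ^ 2 / 2) * A x ^ 2 * G x ^ 2 ≤ -(2 * p ^ 2) * G x ^ 2 * A x ^ 2 := by
        have := mul_le_mul_of_nonneg_right hs4 (mul_pos hA2 hG2).le
        linarith
      have l3 : -(2 * p ^ 2) * G x ^ 2 * A x ^ 2 ≤ (G x * G₂ x - G₁ x ^ 2) * A x ^ 2 := by
        have := mul_le_mul_of_nonneg_right (hGcurv x hx) hA2.le
        linarith
      linarith
    exact no_three_zeros_of_logCurvature_margin hu hA hA' hG hG' hApos hGpos hmargin h₁ h₃ h12 h23
      (hz x₁ (by simp)) (hz x₂ (by simp)) (hz x₃ (by simp))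

end ProductPlusOne

end Summit.ValiantsHypothesis.ValiantsHypothesis.Theorems.LacunarySymmetroidMatrixDescartes
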